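/-
Copyright: the b2b-balaban T⁴-continuum CRUX team, row NE7b OWNER lineage `t4-ne7b-p1` (gen 136). Project licence.
-/
import Summits.QuantumFields.BalabanUV.T4Continuum.Spine.NE7b.SupBlockEffectiveActionHessian
import Summits.QuantumFields.BalabanUV.T4Continuum.Spine.NE7b.SupBlockUpperLetter
import Summits.QuantumFields.BalabanUV.T4Continuum.Spine.NE7b.SupBlockLowerLetter
import Summits.QuantumFields.BalabanUV.T4Continuum.Spine.NE7b.SupEffectiveActionCovariance

/-!
# THE HESSIAN OF A BLOCK-LOCAL INPUT'S NEXT POTENTIAL IS THE COVARIANCE FORMULA, AND THE TWO BLOCK LETTERS PIN ITS DIAGONAL — (320)'s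
# BLOCK TWIN, (d8′)(1) COMPLETED: for a `C²` block potential `U : ℝ^ι → ℝ` with the three block letters of (402), at EVERY `ψ₀`, with
# `ν = e^{−U(ω+ψ₀)}N(0,Γ)∕Z(ψ₀)`,
#   `D²(−log Z)(ψ₀)[h,k] = ⟨U″(ω+ψ₀)[h,k]⟩_ν − ⟨U′(ω+ψ₀)[h]·U′(ω+ψ₀)[k]⟩_ν + ⟨U′[h]⟩_ν⟨U′[k]⟩_ν`   (covariance formula),
#   `−2λ·Σ_iv_i² ≤ D²(−log Z)(ψ₀)[v,v] ≤ Λ·Σ_Yv²`   (the letters (400)∕(401) read on the Hessian: `t → 0⁺` in the gradient's monotonicity),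
# over `N(0,M⁻¹)` for the lower half (floor `m`, `2λ ≤ m`).  With (397)–(402) the whole second-order column (313)∕(316)∕(318)∕(319)∕(320) holds
# verbatim for BLOCK-LOCAL inputs — (388)'s matrix `K_D` and (387)∕(390)∕(391)'s letters follow for a block input by the same one-liners
# (row NE7b, node U5c; (320)∕(400)∕(401)∕(402) BY NAME; [folklore]; [cite: BrascampLieb1976, Thm 4.1])

Cell `pub-balaban`, sub-cell `t4`, spine estimate NE7b (`T4WeightBudget.RelWeightBound`; the cell's OWN estimate — NOT PRINTED in
[Bałaban 1983–89], NOT PROVED).  Crux-route work under `Spine/NE7b/` by the row OWNER (`t4-ne7b-p1` gen 136, file (403)) under FREEZE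
(0)'s crux-prover clause, on this gen's SCOPING-d8 DECISION (d8′)(1); NOTHING of Bałaban's is named as a Lean object, valued or asserted; no
`T4Continuum/Support` leaf typed; no `def`, no notation; zero `sorry`.  Imports (BY NAME): the OWNER's (402) `…SupBlockEffectiveActionHessian`
(`hasFDerivAt_fderiv_block_neg_log`, `block_second_domination`), (400) (`block_neg_log_upper_letter_quadratic`), (401)
(`block_neg_log_lower_letter`), (320) (`hessian_apply_le_of_upper_letter`, `hessian_apply_ge_of_lower_letter`, `cellSq_smul`), (399)
(`integrable_weighted_blockDeriv`, `fderiv_block_neg_log_apply`, `hasFDerivAt_block_neg_log`).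

WHAT IS PROVED ([folklore]):
* §1 `integrable_weightedBlockHess`, **`hessian_block_neg_log_apply`** (the covariance formula for a block input);
* §2 `sq_sum_smul` (2-homogeneity of `Σ_iv_i²`), **`hessian_block_neg_log_le`** (`Hess[v,v] ≤ Λ·Σ_Yv²` from the two-point upper letter of `U`),
  **`hessian_block_neg_log_ge`** (`−2λ·Σ_iv_i² ≤ Hess[v,v]` over `N(0,M⁻¹)` from the secant lower letter, `2λ ≤ m`); §3 toy.

HONEST (what this is NOT).  The second-order column for block inputs; the third-order∕cubic column ((337b)–(339)) and the tilted single-site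
moments ((329)) for block inputs remain ((d8′)(2)); letters are hypotheses on `U`; scalar skeleton ((A3), NC-NE7b-α UNRULED); nothing of
Bałaban's asserted.  BY-NAME EFFECT ON THE WALL: NONE.  NE7b NOT PRINTED ∕ NOT PROVED; spine PROVED 0∕9; rung (B)+1 — the programme's measures
remain FINITE-torus statements; NOT the mass gap, NOT Clay.  HONEST DEPENDENCY: continuum YM on T⁴ ⇐ BetaPertH ∧ nine spine estimates (0∕9
proved); BetaPertH ⇐ (D1) ∧ (D4) ∧ CAP+tail; G-an2-4 gates asym, D1 and NE2∕3∕4.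
-/

set_option autoImplicit false
set_option maxSynthPendingDepth 2

noncomputable section

namespace Summit.QuantumFields.BalabanUV.T4Continuum.NE7b.SupBlockEffectiveActionCovariance

open MeasureTheory ProbabilityTheory Finset Real Metric Filter
open scoped BigOperators Topology Matrix
open SupBlockEffectiveActionHessian (hasFDerivAt_fderiv_block_neg_log block_second_domination)
open SupBlockEffectiveActionDerivative (integrable_weighted_blockDeriv fderiv_block_neg_log_apply hasFDerivAt_block_neg_log)
open SupBlockUpperLetter (block_neg_log_upper_letter_quadratic)
open SupBlockLowerLetter (block_neg_log_lower_letter)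
open SupEffectiveActionCovariance (hessian_apply_le_of_upper_letter hessian_apply_ge_of_lower_letter cellSq_smul)
open SupEffectiveActionDerivative (integrable_domination mul_opBound_le_of_le)

variable {ι : Type} [Fintype ι] [DecidableEq ι]

section Road

variable {Γ : Matrix ι ι ℝ} {γop : ℝ} {U : EuclideanSpace ℝ ι → ℝ} {U' : EuclideanSpace ℝ ι → EuclideanSpace ℝ ι →L[ℝ] ℝ}
  {U'' : EuclideanSpace ℝ ι → EuclideanSpace ℝ ι →L[ℝ] EuclideanSpace ℝ ι →L[ℝ] ℝ} {κ₀ κ₁ κ₂ a τ δ θ : ℝ}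

/-! ## §1. The covariance formula -/

/-- **The weighted second derivative is Bochner integrable** (dominated at the centre of the ball). [folklore] -/
theorem integrable_weightedBlockHess (hΓ : Γ.PosSemidef) (hΓop : (γop • (1 : Matrix ι ι ℝ) - Γ).PosSemidef) (Y : Finset ι)
    (hUd : ∀ φ : EuclideanSpace ℝ ι, HasFDerivAt U (U' φ) φ) (hU'd : ∀ φ : EuclideanSpace ℝ ι, HasFDerivAt U' (U'' φ) φ)
    (hU''c : Continuous U'') (hκ₀ : 0 ≤ κ₀) (hκ₁ : 0 ≤ κ₁) (ha : 0 ≤ a) (hκ₂ : 0 ≤ κ₂) (hτ : 0 < τ) (hδ : 0 < δ) (hθ1 : θ < 1)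
    (hκθ : (2 * κ₀ * (1 + τ) + 4 * δ) * γop ≤ θ) (hstab : ∀ φ : EuclideanSpace ℝ ι, -(κ₀ * ∑ x ∈ Y, φ x ^ 2) ≤ U φ)
    (hU'b : ∀ φ : EuclideanSpace ℝ ι, ‖U' φ‖ ≤ κ₁ * (a + ∑ x ∈ Y, φ x ^ 2)) (hU''b : ∀ φ : EuclideanSpace ℝ ι, ‖U'' φ‖ ≤ κ₂)
    (ψ₀ : EuclideanSpace ℝ ι) :
    Integrable (fun ω : EuclideanSpace ℝ ι => exp (-U (ω + ψ₀)) • (U'' (ω + ψ₀) - (U' (ω + ψ₀)).smulRight (U' (ω + ψ₀))))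
      (multivariateGaussian 0 Γ) := by
  have hU'c : Continuous U' := continuous_iff_continuousAt.2 fun φ => (hU'd φ).continuousAt
  have hUc : Continuous U := continuous_iff_continuousAt.2 fun φ => (hUd φ).continuousAt
  have hF'm : AEStronglyMeasurable (fun ω : EuclideanSpace ℝ ι => exp (-U (ω + ψ₀)) •
      (U'' (ω + ψ₀) - (U' (ω + ψ₀)).smulRight (U' (ω + ψ₀)))) (multivariateGaussian 0 Γ) := by
    refine ((continuous_exp.comp (hUc.comp (continuous_id.add continuous_const)).neg).aestronglyMeasurable).smul ?_
    refine ((hU''c.comp (continuous_id.add continuous_const)).aestronglyMeasurable).sub ?_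
    have hD : AEStronglyMeasurable (fun ω : EuclideanSpace ℝ ι => U' (ω + ψ₀)) (multivariateGaussian 0 Γ) :=
      (hU'c.comp (continuous_id.add continuous_const)).aestronglyMeasurable
    exact isBoundedBilinearMap_smulRight.continuous.comp_aestronglyMeasurable (hD.prodMk hD)
  refine (integrable_domination hΓ hΓop Y hκ₀ hτ hδ hθ1 hκθ
      (exp (κ₀ * (1 + τ⁻¹) * (2 * ∑ x ∈ Y, ψ₀ x ^ 2 + 2)) *
        (κ₂ + κ₁ ^ 2 * (2 * (a + 2 * (2 * ∑ x ∈ Y, ψ₀ x ^ 2 + 2)) ^ 2 + 4 * (δ ^ 2)⁻¹)))).mono' hF'm (ae_of_all _ fun ω => ?_)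
  exact block_second_domination Y hκ₀ hκ₁ ha hκ₂ hτ hδ hstab hU'b hU''b ψ₀ ψ₀ (by rw [sub_self, norm_zero]; exact zero_le_one) ω

/-- **THE HESSIAN APPLIED TO TWO DIRECTIONS IS THE COVARIANCE FORMULA** for a block input: the derivative of (402) applied to `h, k` equals
`Z⁻¹·∫e^{−U}(U″[h,k] − U′[h]·U′[k])dμ + (Z²)⁻¹·(∫e^{−U}U′[h]dμ)(∫e^{−U}U′[k]dμ)` (all at `ω+ψ₀`). [folklore] -/
theorem hessian_block_neg_log_apply (hΓ : Γ.PosSemidef) (hΓop : (γop • (1 : Matrix ι ι ℝ) - Γ).PosSemidef) (Y : Finset ι)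
    (hUd : ∀ φ : EuclideanSpace ℝ ι, HasFDerivAt U (U' φ) φ) (hU'd : ∀ φ : EuclideanSpace ℝ ι, HasFDerivAt U' (U'' φ) φ)
    (hU''c : Continuous U'') (hκ₀ : 0 ≤ κ₀) (hκ₁ : 0 ≤ κ₁) (ha : 0 ≤ a) (hκ₂ : 0 ≤ κ₂) (hτ : 0 < τ) (hδ : 0 < δ) (hθ1 : θ < 1)
    (hκθ : (2 * κ₀ * (1 + τ) + 4 * δ) * γop ≤ θ) (hstab : ∀ φ : EuclideanSpace ℝ ι, -(κ₀ * ∑ x ∈ Y, φ x ^ 2) ≤ U φ)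
    (hU'b : ∀ φ : EuclideanSpace ℝ ι, ‖U' φ‖ ≤ κ₁ * (a + ∑ x ∈ Y, φ x ^ 2)) (hU''b : ∀ φ : EuclideanSpace ℝ ι, ‖U'' φ‖ ≤ κ₂)
    (ψ₀ h k : EuclideanSpace ℝ ι) :
    ((∫ ω : EuclideanSpace ℝ ι, exp (-U (ω + ψ₀)) ∂(multivariateGaussian 0 Γ))⁻¹ •
          (∫ ω : EuclideanSpace ℝ ι, exp (-U (ω + ψ₀)) • (U'' (ω + ψ₀) - (U' (ω + ψ₀)).smulRight (U' (ω + ψ₀)))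
            ∂(multivariateGaussian 0 Γ)) +
        (((∫ ω : EuclideanSpace ℝ ι, exp (-U (ω + ψ₀)) ∂(multivariateGaussian 0 Γ)) ^ 2)⁻¹ •
          ∫ ω : EuclideanSpace ℝ ι, exp (-U (ω + ψ₀)) • U' (ω + ψ₀) ∂(multivariateGaussian 0 Γ)).smulRight
          (∫ ω : EuclideanSpace ℝ ι, exp (-U (ω + ψ₀)) • U' (ω + ψ₀) ∂(multivariateGaussian 0 Γ))) h k =
      (∫ ω : EuclideanSpace ℝ ι, exp (-U (ω + ψ₀)) ∂(multivariateGaussian 0 Γ))⁻¹ *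
          ∫ ω : EuclideanSpace ℝ ι, exp (-U (ω + ψ₀)) * (U'' (ω + ψ₀) h k - U' (ω + ψ₀) h * U' (ω + ψ₀) k)
            ∂(multivariateGaussian 0 Γ) +
        (((∫ ω : EuclideanSpace ℝ ι, exp (-U (ω + ψ₀)) ∂(multivariateGaussian 0 Γ)) ^ 2)⁻¹ *
          ((∫ ω : EuclideanSpace ℝ ι, exp (-U (ω + ψ₀)) * U' (ω + ψ₀) h ∂(multivariateGaussian 0 Γ)) *
            ∫ ω : EuclideanSpace ℝ ι, exp (-U (ω + ψ₀)) * U' (ω + ψ₀) k ∂(multivariateGaussian 0 Γ))) := by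
  have hU'c : Continuous U' := continuous_iff_continuousAt.2 fun φ => (hU'd φ).continuousAt
  have hHint := integrable_weightedBlockHess hΓ hΓop Y hUd hU'd hU''c hκ₀ hκ₁ ha hκ₂ hτ hδ hθ1 hκθ hstab hU'b hU''b ψ₀
  have hGint := integrable_weighted_blockDeriv hΓ hΓop Y hUd hU'c hκ₀ hκ₁ ha hτ hδ hθ1 hκθ hstab hU'b ψ₀
  -- the first-order tilted integrals applied to a direction
  have hG : ∀ v : EuclideanSpace ℝ ι, (∫ ω : EuclideanSpace ℝ ι, exp (-U (ω + ψ₀)) • U' (ω + ψ₀) ∂(multivariateGaussian 0 Γ)) v =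
      ∫ ω : EuclideanSpace ℝ ι, exp (-U (ω + ψ₀)) * U' (ω + ψ₀) v ∂(multivariateGaussian 0 Γ) := fun v => by
    rw [ContinuousLinearMap.integral_apply hGint]
    exact integral_congr_ae (ae_of_all _ fun ω => by simp only [_root_.smul_apply, smul_eq_mul])
  -- the second-order tilted integral applied twice
  have hH1 := ContinuousLinearMap.integral_apply hHint h
  have hHint' := (ContinuousLinearMap.apply ℝ (EuclideanSpace ℝ ι →L[ℝ] ℝ) h).integrable_comp hHint
  have hH2 : (∫ ω : EuclideanSpace ℝ ι, (exp (-U (ω + ψ₀)) • (U'' (ω + ψ₀) - (U' (ω + ψ₀)).smulRight (U' (ω + ψ₀)))) h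
      ∂(multivariateGaussian 0 Γ)) k =
      ∫ ω : EuclideanSpace ℝ ι, exp (-U (ω + ψ₀)) * (U'' (ω + ψ₀) h k - U' (ω + ψ₀) h * U' (ω + ψ₀) k) ∂(multivariateGaussian 0 Γ) := by
    rw [ContinuousLinearMap.integral_apply (by exact hHint')]
    exact integral_congr_ae (ae_of_all _ fun ω => by
      simp only [_root_.smul_apply, _root_.sub_apply, smul_eq_mul, ContinuousLinearMap.smulRight_apply])
  rw [_root_.add_apply, _root_.add_apply, _root_.smul_apply, _root_.smul_apply, hH1, hH2, ContinuousLinearMap.smulRight_apply,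
    _root_.smul_apply, _root_.smul_apply, hG h, hG k, smul_eq_mul, smul_eq_mul, smul_eq_mul]
  ring

/-! ## §2. The two letters read on the Hessian -/

omit [DecidableEq ι] in
/-- `Σ_i v_i²` is 2-homogeneous. [folklore] -/
theorem sq_sum_smul (t : ℝ) (v : EuclideanSpace ℝ ι) : ∑ i, (t • v) i ^ 2 = t ^ 2 * ∑ i, v i ^ 2 := by
  simp only [PiLp.smul_apply, smul_eq_mul, mul_pow, mul_sum]

/-- **THE UPPER LETTER ON THE HESSIAN** for a block input: under (402)'s hypotheses with `0 < θ` and the two-point upper letter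
`U(φ′) ≤ U(φ) + U′(φ)[φ′−φ] + ½Λ·Σ_Y(φ′−φ)²`: at EVERY `ψ₀, v`, the Hessian of (402) applied to `(v,v)` is `≤ Λ·Σ_Yv²`. [folklore] -/
theorem hessian_block_neg_log_le (hΓ : Γ.PosSemidef) (hΓop : (γop • (1 : Matrix ι ι ℝ) - Γ).PosSemidef) (Y : Finset ι)
    (hUd : ∀ φ : EuclideanSpace ℝ ι, HasFDerivAt U (U' φ) φ) (hU'd : ∀ φ : EuclideanSpace ℝ ι, HasFDerivAt U' (U'' φ) φ)
    (hU''c : Continuous U'') (hκ₀ : 0 ≤ κ₀) (hκ₁ : 0 ≤ κ₁) (ha : 0 ≤ a) (hκ₂ : 0 ≤ κ₂) (hτ : 0 < τ) (hδ : 0 < δ) (hθ0 : 0 < θ)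
    (hθ1 : θ < 1) (hκθ : (2 * κ₀ * (1 + τ) + 4 * δ) * γop ≤ θ) (hstab : ∀ φ : EuclideanSpace ℝ ι, -(κ₀ * ∑ x ∈ Y, φ x ^ 2) ≤ U φ)
    (hU'b : ∀ φ : EuclideanSpace ℝ ι, ‖U' φ‖ ≤ κ₁ * (a + ∑ x ∈ Y, φ x ^ 2)) (hU''b : ∀ φ : EuclideanSpace ℝ ι, ‖U'' φ‖ ≤ κ₂) {Λ : ℝ}
    (hwup : ∀ φ φ' : EuclideanSpace ℝ ι, U φ' ≤ U φ + U' φ (φ' - φ) + Λ / 2 * ∑ x ∈ Y, (φ' x - φ x) ^ 2)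
    (ψ₀ v : EuclideanSpace ℝ ι) :
    ((∫ ω : EuclideanSpace ℝ ι, exp (-U (ω + ψ₀)) ∂(multivariateGaussian 0 Γ))⁻¹ •
          (∫ ω : EuclideanSpace ℝ ι, exp (-U (ω + ψ₀)) • (U'' (ω + ψ₀) - (U' (ω + ψ₀)).smulRight (U' (ω + ψ₀)))
            ∂(multivariateGaussian 0 Γ)) +
        (((∫ ω : EuclideanSpace ℝ ι, exp (-U (ω + ψ₀)) ∂(multivariateGaussian 0 Γ)) ^ 2)⁻¹ •
          ∫ ω : EuclideanSpace ℝ ι, exp (-U (ω + ψ₀)) • U' (ω + ψ₀) ∂(multivariateGaussian 0 Γ)).smulRight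
          (∫ ω : EuclideanSpace ℝ ι, exp (-U (ω + ψ₀)) • U' (ω + ψ₀) ∂(multivariateGaussian 0 Γ))) v v ≤
      Λ * ∑ x ∈ Y, v x ^ 2 := by
  have hU'c : Continuous U' := continuous_iff_continuousAt.2 fun φ => (hU'd φ).continuousAt
  have hQ : ∀ (t : ℝ) (u : EuclideanSpace ℝ ι), ∑ x ∈ Y, (t • u) x ^ 2 = t ^ 2 * ∑ x ∈ Y, u x ^ 2 := fun t u => by
    simp only [PiLp.smul_apply, smul_eq_mul, mul_pow, mul_sum]
  have key := hessian_apply_le_of_upper_letter (Q := fun u : EuclideanSpace ℝ ι => ∑ x ∈ Y, u x ^ 2) (c := Λ / 2)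
    (hasFDerivAt_fderiv_block_neg_log hΓ hΓop Y hUd hU'd hU''c hκ₀ hκ₁ ha hκ₂ hτ hδ hθ0 hθ1 hκθ hstab hU'b hU''b ψ₀) hQ
    (fun ψ ψ' => by
      have h := block_neg_log_upper_letter_quadratic hΓ hΓop Y hUd hU'c hκ₀ hκ₁ ha hτ hδ hθ0 hθ1 hκθ hstab hU'b hwup ψ ψ'
      simp only [WithLp.ofLp_sub, Pi.sub_apply]
      exact h) v
  have e : 2 * (Λ / 2) = Λ := by ring
  rw [e] at key
  exact key

/-- **THE LOWER LETTER ON THE HESSIAN** for a block input over `N(0,M⁻¹)` (`M ≻ 0`, floor `m`, `M⁻¹ ⪯ γ_op·1`): under (402)'s hypotheses with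
`0 < θ` and the secant lower letter of `U` of constant `λ ≥ 0` with `2λ ≤ m`: at EVERY `ψ₀, v`, `−2λ·Σ_iv_i² ≤` the Hessian at `(v,v)`.
[folklore] -/
theorem hessian_block_neg_log_ge {M : Matrix ι ι ℝ} {m lam : ℝ} (hM : M.PosDef) (hfl : ∀ z : ι → ℝ, m * ∑ i, z i ^ 2 ≤ z ⬝ᵥ (M *ᵥ z))
    (hΓop : (γop • (1 : Matrix ι ι ℝ) - M⁻¹).PosSemidef) (Y : Finset ι)
    (hUd : ∀ φ : EuclideanSpace ℝ ι, HasFDerivAt U (U' φ) φ) (hU'd : ∀ φ : EuclideanSpace ℝ ι, HasFDerivAt U' (U'' φ) φ)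
    (hU''c : Continuous U'') (hκ₀ : 0 ≤ κ₀) (hκ₁ : 0 ≤ κ₁) (ha : 0 ≤ a) (hκ₂ : 0 ≤ κ₂) (hτ : 0 < τ) (hδ : 0 < δ) (hθ0 : 0 < θ)
    (hθ1 : θ < 1) (hκθ : (2 * κ₀ * (1 + τ) + 4 * δ) * γop ≤ θ) (hstab : ∀ φ : EuclideanSpace ℝ ι, -(κ₀ * ∑ x ∈ Y, φ x ^ 2) ≤ U φ)
    (hU'b : ∀ φ : EuclideanSpace ℝ ι, ‖U' φ‖ ≤ κ₁ * (a + ∑ x ∈ Y, φ x ^ 2)) (hU''b : ∀ φ : EuclideanSpace ℝ ι, ‖U'' φ‖ ≤ κ₂)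
    (hlam : 0 ≤ lam)
    (hUsec : ∀ s : ℝ, 0 ≤ s → s ≤ 1 → ∀ a b : EuclideanSpace ℝ ι,
      U ((1 - s) • a + s • b) - lam / 2 * (s * (1 - s)) * ∑ i, (a i - b i) ^ 2 ≤ (1 - s) * U a + s * U b)
    (hm : 2 * lam ≤ m) (ψ₀ v : EuclideanSpace ℝ ι) :
    -(2 * lam * ∑ i, v i ^ 2) ≤
      ((∫ ω : EuclideanSpace ℝ ι, exp (-U (ω + ψ₀)) ∂(multivariateGaussian 0 M⁻¹))⁻¹ •
          (∫ ω : EuclideanSpace ℝ ι, exp (-U (ω + ψ₀)) • (U'' (ω + ψ₀) - (U' (ω + ψ₀)).smulRight (U' (ω + ψ₀)))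
            ∂(multivariateGaussian 0 M⁻¹)) +
        (((∫ ω : EuclideanSpace ℝ ι, exp (-U (ω + ψ₀)) ∂(multivariateGaussian 0 M⁻¹)) ^ 2)⁻¹ •
          ∫ ω : EuclideanSpace ℝ ι, exp (-U (ω + ψ₀)) • U' (ω + ψ₀) ∂(multivariateGaussian 0 M⁻¹)).smulRight
          (∫ ω : EuclideanSpace ℝ ι, exp (-U (ω + ψ₀)) • U' (ω + ψ₀) ∂(multivariateGaussian 0 M⁻¹))) v v := by
  have hΓ : (M⁻¹).PosSemidef := hM.inv.posSemidef
  have hU'c : Continuous U' := continuous_iff_continuousAt.2 fun φ => (hU'd φ).continuousAt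
  have key := hessian_apply_ge_of_lower_letter (Q := fun u : EuclideanSpace ℝ ι => ∑ i, u i ^ 2) (c := lam)
    (hasFDerivAt_fderiv_block_neg_log hΓ hΓop Y hUd hU'd hU''c hκ₀ hκ₁ ha hκ₂ hτ hδ hθ0 hθ1 hκθ hstab hU'b hU''b ψ₀) sq_sum_smul
    (fun ψ ψ' => by
      have h := block_neg_log_lower_letter hM hfl hΓop Y hUd hU'c hκ₀ hκ₁ ha hτ hδ hθ0 hθ1 hκθ hstab hU'b hlam hUsec hm ψ ψ'
      simp only [WithLp.ofLp_sub, Pi.sub_apply]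
      exact h) v
  exact key

end Road

/-! ## §3. Toy -/

/-- Toy (§2): `Σ_i (t•v)_i² = t²Σ_iv_i²`. -/
example (t : ℝ) (v : EuclideanSpace ℝ ι) : ∑ i, (t • v) i ^ 2 = t ^ 2 * ∑ i, v i ^ 2 := sq_sum_smul t v

end Summit.QuantumFields.BalabanUV.T4Continuum.NE7b.SupBlockEffectiveActionCovariance
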